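import Mathlib.Topology.MetricSpace.Gluing
import HarnessLib

/-!
# The metric wedge of a sequence of metric spaces along a common hub (Bamler 2023, §2.4 Lemma,
# §5.2 Lemma 5.15, §6.2 proof of Thm. 6.4)

R. Bamler, *Compactness theory of the space of super Ricci flows*, Invent. Math. 233 (2023),
§2.4, Lemma (combining isometric embeddings) / §5.2, Lemma 5.15 (arXiv v1 Lemma 114), used in the
proof of Thm. 6.4 (arXiv v1 Thm. 128): *"By an iterative application of Lemma 5.15 we can construct
sequences of correspondences between `𝒳¹, …, 𝒳ᵐ, 𝒳^∞` … Using a direct limit construction, we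
obtain a correspondence `ℭ` between all metric flows `𝒳^i`, `i ∈ ℕ ∪ {∞}`"*, and Remark 6.2 (arXiv
Rmk. 125: *"choose `(Z_t, d^Z_t)` to be the wedge sum of all non-empty `(𝒳^i_t, d^i_t)`"*).

This file carries out that metric construction, time-slice by time-slice being left to the user:
given a HUB metric space `H`, a sequence of metric spaces `Y n`, and for some of the `n`
("active", `Act n`) isometric embeddings `ψ n : H → Y n`, it produces ONE metric space `W` with
isometric embeddings `ι n : Y n → W` of all `Y n` and `hub : H → W` of the hub such that
`ι n ∘ ψ n = hub` for every active `n` — the wedge of the `Y n` along the copies `ψ n (H)` of `H`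
(the inactive `Y n` are attached at distance `1`). Construction, as in the source: iterated metric
gluing (Mathlib's `Metric.GlueSpace` along `H` for active `n`, the sum metric
`Metric.metricSpaceSum` otherwise) and the direct limit `Metric.InductiveLimit` of the resulting
tower of isometric embeddings:

* `MetricWedge.Stage`, `MetricWedge.Step`, `MetricWedge.step`, `MetricWedge.stages` — the tower
  `H = W₀ → W₁ → W₂ → …`, `W_{n+1} = W_n ∪_H Y n` (or `W_n ⊔ Y n`), each stage carrying the
  isometric copy of `H`;
* `MetricWedge H Y Act ψ` (a bundled metric space with `hub`, `ι`, the isometry facts and the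
  commutation) and `metricWedge hψ : MetricWedge H Y Act ψ` — **the wedge**; the registered anchor
  `metricWedge_comm : (metricWedge hψ).ι n (ψ n h x) = (metricWedge hψ).hub x`.

Pure metric geometry; no measurable structures (users take the Borel σ-algebra). No nonemptiness
assumption on `H` or the `Y n` (an empty hub glues nothing).

## References

* R. H. Bamler, *Compactness theory of the space of super Ricci flows*, Invent. Math. 233 (2023),
  1121–1277 (arXiv:2008.09298), §2.4, Lemma (combining isometric embeddings); §5.2, Lemma 5.15;
  §6.1, Remark 6.2; §6.2, proof of Thm. 6.4 (arXiv v1 Thm. 128). [Bamler2023]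
-/

noncomputable section

open Set Function
open scoped Topology

namespace Literature.Geometry.Riemannian

universe u

namespace MetricWedge

variable (H : Type u) [MetricSpace H]

/-- A stage `W_n` of the tower: a metric space with an isometric copy of the hub `H`.
[cite: Bamler2023, §6.2, proof of Thm. 6.4 (direct limit construction)] -/
structure Stage : Type (u + 1) where
  /-- The metric space `W_n`. -/
  carrier : Type u
  /-- Its metric. -/
  [metric : MetricSpace carrier]
  /-- The isometric copy of the hub. -/
  emb : H → carrier
  /-- `emb` is an isometric embedding. -/
  isometry_emb : Isometry emb

attribute [instance] Stage.metric

variable {H}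

/-- One step of the tower: the next stage `W_{n+1}` together with the isometric embeddings of
`W_n` and of `Y` into it, compatible with the copies of the hub, and — if the gluing map
`ψ : H → Y` is available (`P`) — identifying `ψ (H)` with the hub.
[cite: Bamler2023, §5.2, Lemma 5.15; §6.2, proof of Thm. 6.4] -/
structure Step (S : Stage H) (Y : Type u) [MetricSpace Y] (P : Prop) (ψ : P → H → Y) :
    Type (u + 1) where
  /-- The next stage `W_{n+1}`. -/
  next : Stage H
  /-- The inclusion `W_n → W_{n+1}`. -/
  incl : S.carrier → next.carrier
  /-- The inclusion `Y → W_{n+1}`. -/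
  inY : Y → next.carrier
  /-- `incl` is an isometric embedding. -/
  isometry_incl : Isometry incl
  /-- `inY` is an isometric embedding. -/
  isometry_inY : Isometry inY
  /-- The copies of the hub are compatible. -/
  incl_emb : ∀ x, incl (S.emb x) = next.emb x
  /-- `ψ (H)` is identified with the hub. -/
  comm : ∀ (h : P) (x : H), inY (ψ h x) = next.emb x

/-- The disjoint-union step `W_{n+1} := W_n ⊔ Y` (sum metric: the two pieces at distance `≥ 1`),
used when nothing is to be glued. [cite: Bamler2023, §6.1, Remark 6.2] -/
def Step.sum (S : Stage H) (Y : Type u) [MetricSpace Y] (P : Prop) (ψ : P → H → Y)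
    (hvac : P → IsEmpty H) : Step S Y P ψ := by
  letI : MetricSpace (S.carrier ⊕ Y) := Metric.metricSpaceSum
  exact
    { next :=
        { carrier := S.carrier ⊕ Y
          metric := Metric.metricSpaceSum
          emb := Sum.inl ∘ S.emb
          isometry_emb := Metric.isometry_inl.comp S.isometry_emb }
      incl := Sum.inl
      inY := Sum.inr
      isometry_incl := Metric.isometry_inl
      isometry_inY := Metric.isometry_inr
      incl_emb := fun _ ↦ rfl
      comm := fun h x ↦ ((hvac h).false x).elim }

/-- **The gluing step** `W_{n+1} := W_n ∪_H Y` (Mathlib's `Metric.GlueSpace` of `W_n` and `Y`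
along the isometric embeddings of the hub, Bamler 2023, §2.4, Lemma (combining isometric
embeddings)) when `ψ` is available and `H ≠ ∅`; the disjoint union otherwise.
[cite: Bamler2023, §2.4, Lemma (combining isometric embeddings)] -/
def step (S : Stage H) (Y : Type u) [MetricSpace Y] (P : Prop) (ψ : P → H → Y)
    (hψ : ∀ h, Isometry (ψ h)) : Step S Y P ψ := by
  classical
  exact if h : P then
    if hH : Nonempty H then
      haveI : Nonempty H := hH
      { next :=
          { carrier := Metric.GlueSpace S.isometry_emb (hψ h)
            metric := inferInstance
            emb := Metric.toGlueL S.isometry_emb (hψ h) ∘ S.emb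
            isometry_emb := (Metric.toGlueL_isometry _ _).comp S.isometry_emb }
        incl := Metric.toGlueL S.isometry_emb (hψ h)
        inY := Metric.toGlueR S.isometry_emb (hψ h)
        isometry_incl := Metric.toGlueL_isometry _ _
        isometry_inY := Metric.toGlueR_isometry _ _
        incl_emb := fun _ ↦ rfl
        comm := fun _ x ↦ (congrFun (Metric.toGlue_commute S.isometry_emb (hψ h)) x).symm }
    else Step.sum S Y P ψ fun _ ↦ ⟨fun x ↦ hH ⟨x⟩⟩
  else Step.sum S Y P ψ fun h' ↦ (h h').elim

variable (H) in
/-- The initial stage `W₀ := H`. [cite: Bamler2023, §6.2, proof of Thm. 6.4] -/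
def Stage.init : Stage H where
  carrier := H
  metric := inferInstance
  emb := id
  isometry_emb := isometry_id

variable (Y : ℕ → Type u) [∀ n, MetricSpace (Y n)] (Act : ℕ → Prop) (ψ : ∀ n, Act n → H → Y n)
  (hψ : ∀ n h, Isometry (ψ n h))

/-- **The tower** `W₀ := H`, `W_{n+1} := W_n ∪_H Y n` (glued along `ψ n (H)` if `Act n`, disjoint
union otherwise). [cite: Bamler2023, §6.2, proof of Thm. 6.4 (iterative application of Lemma 5.15)] -/
def stages : ℕ → Stage H
  | 0 => Stage.init H
  | n + 1 => (step (stages n) (Y n) (Act n) (ψ n) (hψ n)).next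

/-- The `n`-th step of the tower (from `W_n` to `W_{n+1}`).
[cite: Bamler2023, §6.2, proof of Thm. 6.4] -/
def steps (n : ℕ) : Step (stages Y Act ψ hψ n) (Y n) (Act n) (ψ n) :=
  step (stages Y Act ψ hψ n) (Y n) (Act n) (ψ n) (hψ n)

/-- The connecting isometric embeddings `W_n → W_{n+1}` of the tower.
[cite: Bamler2023, §6.2, proof of Thm. 6.4] -/
def connect (n : ℕ) : (stages Y Act ψ hψ n).carrier → (stages Y Act ψ hψ (n + 1)).carrier :=
  (steps Y Act ψ hψ n).incl

/-- The connecting maps are isometric embeddings. [cite: Bamler2023, §6.2, proof of Thm. 6.4] -/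
theorem isometry_connect (n : ℕ) : Isometry (connect Y Act ψ hψ n) :=
  (steps Y Act ψ hψ n).isometry_incl

/-- `W_{n+1}` is the next stage of the `n`-th step. [cite: Bamler2023, §6.2, proof of Thm. 6.4] -/
theorem stages_succ (n : ℕ) : stages Y Act ψ hψ (n + 1) = (steps Y Act ψ hψ n).next := rfl

/-- The copy of the hub in `W_{n+1}` is the image of the copy in `W_n`.
[cite: Bamler2023, §6.2, proof of Thm. 6.4] -/
theorem connect_emb (n : ℕ) (x : H) :
    connect Y Act ψ hψ n ((stages Y Act ψ hψ n).emb x) = (stages Y Act ψ hψ (n + 1)).emb x :=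
  (steps Y Act ψ hψ n).incl_emb x

/-- In the direct limit, all copies of the hub agree with the initial one: the image of
`emb_n (x) ∈ W_n` is the image of `x ∈ W₀ = H`. [cite: Bamler2023, §6.2, proof of Thm. 6.4] -/
theorem toInductiveLimit_emb (n : ℕ) (x : H) :
    Metric.toInductiveLimit (isometry_connect Y Act ψ hψ) n ((stages Y Act ψ hψ n).emb x) =
      Metric.toInductiveLimit (isometry_connect Y Act ψ hψ) 0 x := by
  induction n with
  | zero => rfl
  | succ n ih =>
    rw [← ih, ← Metric.toInductiveLimit_commute (isometry_connect Y Act ψ hψ) n, comp_apply,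
      connect_emb]

end MetricWedge

/-- **The metric wedge of a sequence of metric spaces along a common hub, bundled** (Bamler 2023,
§6.1 Remark 6.2, §6.2 proof of Thm. 6.4): a metric space `W` with isometric embeddings
`ι n : Y n → W` and `hub : H → W` identifying `ψ n (H)` with the hub for every active `n`.
[cite: Bamler2023, §6.2, proof of Thm. 6.4 (arXiv v1 Thm. 128)] -/
structure MetricWedge (H : Type u) [MetricSpace H] (Y : ℕ → Type u) [∀ n, MetricSpace (Y n)]
    (Act : ℕ → Prop) (ψ : ∀ n, Act n → H → Y n) : Type (u + 1) where
  /-- The wedge `W`. -/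
  carrier : Type u
  /-- Its metric. -/
  [metric : MetricSpace carrier]
  /-- The isometric copy of the hub. -/
  hub : H → carrier
  /-- The isometric copies of the `Y n`. -/
  ι : ∀ n, Y n → carrier
  /-- `hub` is an isometric embedding. -/
  isometry_hub : Isometry hub
  /-- Each `ι n` is an isometric embedding. -/
  isometry_ι : ∀ n, Isometry (ι n)
  /-- For active `n`, `ψ n (H)` is the hub. -/
  comm : ∀ n (h : Act n) (x : H), ι n (ψ n h x) = hub x

attribute [instance] MetricWedge.metric

/-- **The metric wedge** of the `Y n` along the copies `ψ n (H)` of the hub (`n` active), the other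
`Y n` attached at distance `1`: the direct limit (`Metric.InductiveLimit`) of the tower of iterated
gluings `MetricWedge.stages`. [cite: Bamler2023, §6.2, proof of Thm. 6.4 (arXiv v1 Thm. 128)] -/
def metricWedge {H : Type u} [MetricSpace H] {Y : ℕ → Type u} [∀ n, MetricSpace (Y n)]
    {Act : ℕ → Prop} {ψ : ∀ n, Act n → H → Y n} (hψ : ∀ n h, Isometry (ψ n h)) :
    MetricWedge H Y Act ψ where
  carrier := Metric.InductiveLimit (MetricWedge.isometry_connect Y Act ψ hψ)
  metric := inferInstance
  hub := Metric.toInductiveLimit (MetricWedge.isometry_connect Y Act ψ hψ) 0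
  ι n := Metric.toInductiveLimit (MetricWedge.isometry_connect Y Act ψ hψ) (n + 1) ∘
    (MetricWedge.steps Y Act ψ hψ n).inY
  isometry_hub := Metric.toInductiveLimit_isometry _ 0
  isometry_ι n := (Metric.toInductiveLimit_isometry _ (n + 1)).comp
    (MetricWedge.steps Y Act ψ hψ n).isometry_inY
  comm n h x := by
    show Metric.toInductiveLimit (MetricWedge.isometry_connect Y Act ψ hψ) (n + 1)
      ((MetricWedge.steps Y Act ψ hψ n).inY (ψ n h x)) = _
    rw [(MetricWedge.steps Y Act ψ hψ n).comm h x]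
    exact MetricWedge.toInductiveLimit_emb Y Act ψ hψ (n + 1) x

/-- **The wedge identifies each copy `ψ n (H)` with the hub** (registered anchor of this file):
`ι n (ψ n h x) = hub x` for active `n`. [cite: Bamler2023, §6.2, proof of Thm. 6.4 (arXiv v1 Thm. 128)] -/
theorem metricWedge_comm {H : Type u} [MetricSpace H] {Y : ℕ → Type u} [∀ n, MetricSpace (Y n)]
    {Act : ℕ → Prop} {ψ : ∀ n, Act n → H → Y n} (hψ : ∀ n h, Isometry (ψ n h)) (n : ℕ)
    (h : Act n) (x : H) : (metricWedge hψ).ι n (ψ n h x) = (metricWedge hψ).hub x :=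
  (metricWedge hψ).comm n h x

/-- The embeddings of the pieces into the wedge are isometric embeddings.
[cite: Bamler2023, §6.2, proof of Thm. 6.4 (arXiv v1 Thm. 128)] -/
theorem isometry_metricWedge_ι {H : Type u} [MetricSpace H] {Y : ℕ → Type u}
    [∀ n, MetricSpace (Y n)] {Act : ℕ → Prop} {ψ : ∀ n, Act n → H → Y n}
    (hψ : ∀ n h, Isometry (ψ n h)) (n : ℕ) : Isometry ((metricWedge hψ).ι n) :=
  (metricWedge hψ).isometry_ι n

/-- The embedding of the hub into the wedge is an isometric embedding.
[cite: Bamler2023, §6.2, proof of Thm. 6.4 (arXiv v1 Thm. 128)] -/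
theorem isometry_metricWedge_hub {H : Type u} [MetricSpace H] {Y : ℕ → Type u}
    [∀ n, MetricSpace (Y n)] {Act : ℕ → Prop} {ψ : ∀ n, Act n → H → Y n}
    (hψ : ∀ n h, Isometry (ψ n h)) : Isometry (metricWedge hψ).hub :=
  (metricWedge hψ).isometry_hub

end Literature.Geometry.Riemannian

end
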